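import Literature.NumberTheory.EllipticCurves.HWang2023.BaseChangeFreenessHypotheses
import Literature.NumberTheory.EllipticCurves.HeightDensityFullBSDOffS
import HarnessLib

/-!
# `DT` / `PO` / `Clean` (H. Wang 2023 §1 hypotheses specialised to the BCS25 base change) — elementary API PROVED

Sibling of `HWang2023/BaseChangeFreenessHypotheses.lean` (definitions; typer seat
`bsd-litref-bcs25-ty`, cell `bsd-litref/bcs25`). Proved bookkeeping only: a level-lowering prime is
not a `Ram` witness; `DT` in the absence of level-lowering / multiplicative primes; Wang's (PO) for
`g_F` as «`a_p(E)² ≢ ±1 (mod p)`»; and **`PO` (hence `Clean`) is identically false at an ordinary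
`p = 5`** (Fermat: `a⁴ ≡ 1 (mod 5)` for `5 ∤ a`) — the structural fact behind the certified table's
«p = 5: 1 757 / 1 757 PO-FAIL, CLEAN = 0» (`pub/bsd-ssimc/audit1/CERT-DT-WITNESS-v1.md`; referee C
R274.1 (c)). Appended 2026-08-26 (same seat, gen 2): `DT E p ⟺ p ∉ Z*(E)` — the kernel bridge to the
exceptional set `InZstar` of `HeightDensityFullBSDOffS.lean` (PERCENT-FULL rows (ii-1)/(ii-2),
CITED-FACTS D41), so that ONE name keys W. Zhang 2014 Thm. 1.4 (2), Wang's (𝔫⁺-DT), the D1 DT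
register and `Z*(E)` (lane row T-ZH14, referee A ROUND 336: predicate zh2 «= `HWang2023.DT W p` =
¬`InZstar W p`»). No fact, nothing asserted beyond what is proved here.

## References
* [HWang2023AnticyclotomicHMF] H. Wang, Ann. Math. Québec 47 (2023) = arXiv:1909.12374, §1 (PO),
  (𝔫⁺-DT) (chunk p0004:L44–51); Thm. 9.1 (chunk p0031:L30–31).
* `pub/bsd-ssimc/audit1-DAUDIT-1-addC.md` §C.4–C.5; `pub/pub-bsdpct/REFEREE.md` ROUND 274.
-/

noncomputable section

open scoped Classical

open WeierstrassCurve Literature.NumberTheory.EllipticCurves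
  Literature.NumberTheory.EllipticCurves.Rank1Residual

namespace Literature.NumberTheory.EllipticCurves.HWang2023

variable (W : WeierstrassCurve ℚ) [W.IsGloballyMinimal] (p : ℕ)

/-- A level-lowering prime is NOT a `Ram`-witness for the same `(E, p)`: at it `p ∣ ord_ℓ(Δ_min)`
(projection; nothing asserted). [cite: HWang2023AnticyclotomicHMF, §9.1 (chunk p0031:L7–9), unfolding only] -/
theorem IsLevelLoweringPrime.dvd {W : WeierstrassCurve ℚ} [W.IsGloballyMinimal] {p ℓ : ℕ}
    [Fact ℓ.Prime] (h : IsLevelLoweringPrime W p ℓ) :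
    p ∣ padicValInt ℓ W.minimalDiscriminantInt :=
  h.2

/-- `DT` holds vacuously when `(E, p)` has no level-lowering prime, e.g. when `ρ̄_{E,p}` is ramified
at EVERY multiplicative prime (`p ∤ ord_ℓ(Δ_min)` for all `ℓ ∥ N`) — in particular for a curve
with no multiplicative prime at all (bookkeeping from the definition).
[cite: HWang2023AnticyclotomicHMF, §1 Hypothesis (𝔫⁺-DT) (chunk p0004:L44–45), trivial case] -/
theorem dt_of_forall_not_dvd
    (h : ∀ ℓ : ℕ, (hℓ : ℓ.Prime) →
      (haveI : Fact ℓ.Prime := ⟨hℓ⟩; W.HasMultiplicativeReductionAtPrime ℓ) →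
        ¬ p ∣ padicValInt ℓ W.minimalDiscriminantInt) :
    DT W p := by
  intro ℓ hℓ hLR _
  exact h ℓ hℓ hLR.1 hLR.2

/-- `DT` from the absence of multiplicative primes (bookkeeping from the definition). [cite: HWang2023AnticyclotomicHMF, §1 Hypothesis (𝔫⁺-DT) (chunk p0004:L44–45), trivial case] -/
theorem dt_of_forall_not_mult
    (h : ∀ ℓ : ℕ, (hℓ : ℓ.Prime) →
      ¬ (haveI : Fact ℓ.Prime := ⟨hℓ⟩; W.HasMultiplicativeReductionAtPrime ℓ)) :
    DT W p :=
  dt_of_forall_not_dvd W p fun ℓ hℓ hm _ ↦ h ℓ hℓ hm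

/-- For a prime `p`: `p ∤ a⁴ − 1 ⟺ (p ∤ a² − 1 ∧ p ∤ a² + 1)` (`a⁴ − 1 = (a² − 1)(a² + 1)` and Euclid's
lemma) — Wang's (PO) for `g_F` read as «`a_p(E)² ≢ ±1 (mod p)`» (audit-1 addC §C.4 (A)).
[cite: HWang2023AnticyclotomicHMF, §1 Hypothesis (PO) (chunk p0004:L49–51), elementary reformulation] -/
theorem po_iff_sq [hp : Fact p.Prime] :
    PO W p ↔ ¬ (p : ℤ) ∣ W.frobeniusTrace p ^ 2 - 1 ∧ ¬ (p : ℤ) ∣ W.frobeniusTrace p ^ 2 + 1 := by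
  have hfac : W.frobeniusTrace p ^ 4 - 1 =
      (W.frobeniusTrace p ^ 2 - 1) * (W.frobeniusTrace p ^ 2 + 1) := by ring
  have hpz : Prime (p : ℤ) := Nat.prime_iff_prime_int.mp hp.out
  rw [po_iff, hfac, hpz.dvd_mul, not_or]

/-- **`PO` is identically false at an ordinary `p = 5`**: if `5 ∤ a_5` then `a_5⁴ ≡ 1 (mod 5)`
(Fermat), so `5 ∣ a_5⁴ − 1`. Matches the certified table (all 1 757 D1 instances at `p = 5` are
PO-FAIL; referee C R274.1 (c)). [cite: HWang2023AnticyclotomicHMF, §1 Hypothesis (PO) (chunk p0004:L49–51), its failure at an inert p = 5 in weight 2] -/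
theorem not_po_five (hord : ¬ (5 : ℤ) ∣ W.frobeniusTrace 5) : ¬ PO W 5 := by
  intro hPO
  apply hPO
  haveI : Fact (Nat.Prime 5) := ⟨by decide⟩
  have h5 : ((W.frobeniusTrace 5 : ℤ) : ZMod 5) ≠ 0 := by
    rwa [Ne, ZMod.intCast_zmod_eq_zero_iff_dvd]
  have hpow : ((W.frobeniusTrace 5 : ℤ) : ZMod 5) ^ 4 = 1 := by
    have := ZMod.pow_card_sub_one_eq_one h5
    simpa using this
  have : ((W.frobeniusTrace 5 ^ 4 - 1 : ℤ) : ZMod 5) = 0 := by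
    push_cast
    rw [hpow, sub_self]
  exact_mod_cast (ZMod.intCast_zmod_eq_zero_iff_dvd _ 5).mp this

/-- On a GOOD ORDINARY pair at `5` (`Rank1Residual.GoodOrd W 5`: good and `5 ∤ a_5`), `PO` fails and
hence so does `Clean`. [cite: HWang2023AnticyclotomicHMF, Thm. 9.1 hypotheses (chunk p0031:L30–31) with (PO) (p0004:L49–51), their failure at p = 5] -/
theorem not_clean_five [Fact (Nat.Prime 5)] (hord : GoodOrd W 5) : ¬ Clean W 5 :=
  fun h ↦ not_po_five W hord.2 h.2


/-- **`DT` IS W. Zhang's Theorem 1.4 hypothesis (2), AS TYPED in the tree.** W. Zhang, Camb. J. Math. 2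
(2014), Thm. 1.4 (p. 197): "(2) If `ℓ ≡ ±1 mod p` and `ℓ ∥ N`, then `ρ̄_{E,p}` is ramified at `ℓ`" —
transcribed in the tree fact `WZhang2014_padicValRat_bsd_rank_one_ordinary`
(`LeadingTermPPartRankLeOne.lean`, binder `h2`) as `∀ ℓ, ℓ ∥ N → (p ∣ ℓ − 1 ∨ p ∣ ℓ + 1) →
p ∤ ord_ℓ(Δ_min)` (ℕ-divisibility) — is, condition for condition, Wang's (𝔫⁺-DT) for the base
change `g_F` of BCS Prop. 5.2.1, i.e. this file's `DT W p` (ℤ-divisibility `(p:ℤ) ∣ ℓ ∓ 1`, stated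
on the level-lowering primes). So the D1 register's DT-FAIL instances (328 / 18 698, audit-1 addC
§C.5) are exactly the instances failing Zhang's (2), and the preprint-free Zhang road (referee A
R151.2 / R154.2) and the CLEAN sub-population of R274 are keyed by ONE predicate. Elementary
(`ℓ ≥ 2`, so `((ℓ − 1 : ℕ) : ℤ) = ℓ − 1`; contraposition).
[cite: WZhang2014, Thm. 1.4 (2) (p. 197)]
[cite: HWang2023AnticyclotomicHMF, §1 Hypothesis (𝔫⁺-DT) (chunk p0004:L44–45)] -/
theorem dt_iff_zhang_thm14_hyp2 :
    DT W p ↔ ∀ (ℓ : ℕ) [Fact ℓ.Prime], W.HasMultiplicativeReductionAtPrime ℓ →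
      (p ∣ ℓ - 1 ∨ p ∣ ℓ + 1) → ¬ p ∣ padicValInt ℓ W.minimalDiscriminantInt := by
  -- `ℓ ≡ ±1 (mod p)` in `ℤ` versus in `ℕ`, for `ℓ ≥ 1`
  have key : ∀ ℓ : ℕ, 1 ≤ ℓ →
      (((p : ℤ) ∣ (ℓ : ℤ) - 1 ∨ (p : ℤ) ∣ (ℓ : ℤ) + 1) ↔ (p ∣ ℓ - 1 ∨ p ∣ ℓ + 1)) := by
    intro ℓ hℓ
    have h1 : ((ℓ - 1 : ℕ) : ℤ) = (ℓ : ℤ) - 1 := by push_cast [Nat.cast_sub hℓ]; ring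
    have h2 : ((ℓ + 1 : ℕ) : ℤ) = (ℓ : ℤ) + 1 := by push_cast; ring
    rw [← h1, ← h2, Int.natCast_dvd_natCast, Int.natCast_dvd_natCast]
  constructor
  · intro h ℓ hℓ hmult hcong hdvd
    have hℓp : ℓ.Prime := hℓ.out
    exact h ℓ hℓp ⟨hmult, hdvd⟩ ((key ℓ hℓp.one_lt.le).mpr hcong)
  · intro h ℓ hℓ hLR hcong
    haveI : Fact ℓ.Prime := ⟨hℓ⟩
    exact h ℓ hLR.1 ((key ℓ hℓ.one_lt.le).mp hcong) hLR.2

/-- Consequently Zhang's hypothesis (2) FAILS at an instance exactly when `DT` fails there — e.g. at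
every one of the 328 DT-FAIL D1 instances (all at `p ≤ 11`, audit-1 addC §C.5); conversely every
DT-PASS instance meets Zhang's (2) (his (1), (3), (4) are separate). Bookkeeping restatement of
`dt_iff_zhang_thm14_hyp2` in the negative. [cite: WZhang2014, Thm. 1.4 (2) (p. 197)] -/
theorem not_dt_iff_exists_zhang_hyp2_offender :
    ¬ DT W p ↔ ∃ (ℓ : ℕ) (_ : Fact ℓ.Prime), W.HasMultiplicativeReductionAtPrime ℓ ∧
      (p ∣ ℓ - 1 ∨ p ∣ ℓ + 1) ∧ p ∣ padicValInt ℓ W.minimalDiscriminantInt := by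
  rw [dt_iff_zhang_thm14_hyp2]
  push Not
  constructor
  · rintro ⟨ℓ, hℓ, hm, hc, hd⟩
    exact ⟨ℓ, hℓ, hm, hc, hd⟩
  · rintro ⟨ℓ, hℓ, hm, hc, hd⟩
    exact ⟨ℓ, hℓ, hm, hc, hd⟩

/-! ### `DT` versus the exceptional set `Z*(E)` (`InZstar`, `HeightDensityFullBSDOffS.lean`) -/

/-- **`DT` fails at `p` iff `p ∈ Z*(E)`.** `InZstar W p` (CITED-FACTS D41; the negation of the binder
`hZstar` of `Rank1Residual.bsdp_of_S30_of_WZhang2014`) is, symbol for symbol, the right-hand side of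
`not_dt_iff_exists_zhang_hyp2_offender`: some multiplicative `ℓ` with `ℓ ≡ ±1 (mod p)` and
`p ∣ v_ℓ(Δ_min)`. Definitional unfolding only. [cite: WZhang2014, Thm. 1.4 (2) (p. 197)] -/
theorem not_dt_iff_inZstar : ¬ DT W p ↔ InZstar W p :=
  not_dt_iff_exists_zhang_hyp2_offender W p

/-- **`DT E p ⟺ p ∉ Z*(E)`** — the lane's predicate zh2 of row T-ZH14 (referee A ROUND 336) under its
three names: Wang's (𝔫⁺-DT) for `g_F` (`DT`), W. Zhang 2014 Thm. 1.4 (2)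
(`dt_iff_zhang_thm14_hyp2`), and `p ∉ Z*(E)` (`InZstar`, PERCENT-FULL rows (ii-1)/(ii-2)).
[cite: WZhang2014, Thm. 1.4 (2) (p. 197)]
[cite: HWang2023AnticyclotomicHMF, §1 Hypothesis (𝔫⁺-DT) (chunk p0004:L44–45)] -/
theorem dt_iff_not_inZstar : DT W p ↔ ¬ InZstar W p := by
  rw [← not_dt_iff_inZstar, not_not]

/-- W. Zhang 2014 Thm. 1.4 hypothesis (2), in the exact binder form `h2` of the tree fact
`WZhang2014_padicValRat_bsd_rank_one_ordinary` and of the row-C2 doors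
`Summit.BirchSwinnertonDyer.Rank1Residual.RowC2.bsdp_rankOne_of_zhang` / `…_of_two_ram`, holds iff
`p ∉ Z*(E)`. [cite: WZhang2014, Thm. 1.4 (2) (p. 197)] -/
theorem zhang_thm14_hyp2_iff_not_inZstar :
    (∀ (ℓ : ℕ) [Fact ℓ.Prime], W.HasMultiplicativeReductionAtPrime ℓ →
      (p ∣ ℓ - 1 ∨ p ∣ ℓ + 1) → ¬ p ∣ padicValInt ℓ W.minimalDiscriminantInt) ↔ ¬ InZstar W p :=
  (dt_iff_zhang_thm14_hyp2 W p).symm.trans (dt_iff_not_inZstar W p)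

/-- Hence `Clean E p` (`DT ∧ PO`, the sub-population with a refereed STATEMENT of the quaternionic
freeness, H. Wang 2023 Thm. 9.1) lies inside the complement of `Z*(E)`.
[cite: HWang2023AnticyclotomicHMF, §1 Hypothesis (𝔫⁺-DT) (chunk p0004:L44–45)]
[cite: WZhang2014, Thm. 1.4 (2) (p. 197)] -/
theorem Clean.not_inZstar {W : WeierstrassCurve ℚ} [W.IsGloballyMinimal] {p : ℕ} (h : Clean W p) :
    ¬ InZstar W p :=
  (dt_iff_not_inZstar W p).mp h.1

end Literature.NumberTheory.EllipticCurves.HWang2023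

end
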